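import Summits.NavierStokesRegularity.NavierStokesRegularity.Theses.ExtremiserTransience
import Summits.NavierStokesRegularity.NavierStokesRegularity.Theorems.ExtremiserTransienceNearExtremalTransienceDSSLogMean
import Summits.NavierStokesRegularity.NavierStokesRegularity.Theorems.ExtremiserTransienceNearExtremalTransienceSharpConstant
import Summits.NavierStokesRegularity.NavierStokesRegularity.Theorems.ExtremiserTransienceNearExtremalTransienceExtremiserLiouvilleConstantSpeedEnergyFluxJet
import Literature.Analysis.FluidPDE.BlowupAncientSolution
import Literature.Analysis.FluidPDE.NSBoundedMildOseen
import Literature.Analysis.FluidPDE.MildSolution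
import HarnessLib.Audit

/-!
REV 2 (2026-08-29, after critic V88/N96): stub signatures named `Sig.StubC/StubA/StubB` (P4); typed upstream targets of the
mean-value sign law — T4 mass equality (α), T5 zero force (α+γ), T6 tail law (β), T7 far-field Caccioppoli = τ-bootstrap (P6) — live in
`Lines/kernel_budget_signlaw.lean` over the tree multiplier API; identity (ii) of N96 is the tree theorem
`ExtremiserLiouville.multiplier_integral_normSq_sub` (P7).  STATUS WORDING (P3): this line is a JET-killer modulo C and B as wired here; after
rev 1.1/2 its K1b residual of record = S1 (representation, untyped: needs the explicit Oseen–Yukawa tensor, deferred) ∧ T7 ∧ the slab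
absorption step (δ); FLAT (C) and JET (A, B) are both conditional on them.  No summit, crux or K1b is proved by this file.

# Crux `ExtremiserTransience.NearExtremalTransience` (stmt-NavierStokesRegularity-21883) — LINE «kernel_budget»
# (ideator seat ns-idea-10, generation 7, lens «rescuer»; files-only line, no registry writes)

RESCUED DEATH.  Line `extremiser_liouville` (line B) reduced the crux to the STATIC stub K1b (`stub_noAnalyticExtremal`), and the
K1b seat (g3–g6) reduced K1b — kernel-checked, tree theorem
`Theorems.ExtremiserLiouville.stub_noAnalyticExtremal_of_noJetObject` — to the exclusion of the RESIDUE OBJECT: a real-analytic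
`w`, `‖w‖ ≡ M = ‖c‖`, `w → c` at infinity, `D¹w, D²w ∈ L²`, EXACTLY extremal (`κ⋆·M·√Z·√W = |S|`), which is either FLAT (some slab
`{|ξ| ≤ T}` carries infinite energy `∫‖w − c‖²`) or a JET (all slabs finite, all window energies equal to one `E₀ > 0`).  Its recorded
stuck point (`Lines/extremiser_liouville_k1b_jet.md` §6): "the whole jet alternative dies once an annular Caccioppoli estimate for the
rescaled Euler–Lagrange system gives `L²_loc` compactness of the blow-downs — the one estimate left"; recorded dead line: profile /
blow-down theorems at a fixed homogeneity (the object need not be asymptotically homogeneous).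

THE DODGE (new lever: the FUNDAMENTAL SOLUTION of the linearised Euler–Lagrange operator + the MOMENTUM BUDGET of the multiplier).
The linear part of the E–L system of `Ψ = S² − κ⋆²M²ZW` at the residue object is `𝕃 = κ⋆²M²(W·Δ − Z·Δ²) = −κ⋆²M²Z·(−Δ)(−Δ + ℓ⋆⁻²)`,
`ℓ⋆ = √(Z/W)`, acting on `V := w − c`, with right-hand side `v·μ − S·∇·τ` (μ = the K1b multiplier measure, FINITE, `μ(ℝ³) ≤ κ⋆²ZW`,
tree `exists_multiplierMeasure`; τ ∈ L¹ the quadratic stretching tensors).  `−𝕃∘ℙ` has an EXPLICIT divergence-free fundamental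
solution `𝒰` (Oseen tensor minus its Brinkman-screened copy, divided by `κ⋆²M²W`): bounded at the origin, `𝒰 ~ Stokeslet/(κ⋆²M²W)`
at infinity, `|∇𝒰| ≲ r⁻²`.  (S1) REPRESENTATION `V = −𝒰 ∗ (vμ) + S·∇𝒰 ∗ τ` (tempered Liouville: `V` bounded and `→ 0`).  Compactness of
blow-downs now comes FROM THE KERNEL (finite measures are mapped compactly into `L²_loc`), not from an energy (Caccioppoli) estimate —
this is the dodge.  (S2) NO DRAG from the SIGN LAW `V_ξ = −‖V‖²/(2M) ≤ 0` (`‖w‖ ≡ M`): the monopole term `−𝒰(x)·b`, `b = ∫v dμ`,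
`⟪b, c⟫ = M²μ(ℝ³) − S² ≤ 0`, has `(V_ξ)₊ ≳ |b|/r` on a sector while every other term is `o(1/r)` in `L¹(A_r)`-average ⇒ `b = 0` for
EVERY residue object (for the jet this is already the tree theorem `integral_eq_zero_of_jet`).  (S3) ANNULAR DECAY
`r⁻¹∫_{r<|x|<2r}‖V‖² → 0` from `b = 0` + (S1) by potential estimates (dominated convergence for the core dipole, Minkowski for the
shell mass, HLS + `‖ω‖_{L²(A_r)} → 0` for the quadratic term) — no rate, no homogeneity; it kills every axial / sub-conical / conical
jet (a tube segment inside `A_r` carries energy `≥ 0.8·E₀·r`).  (S4) NO CONDUIT JET: the only jet compatible with (S3) lets its window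
energy escape super-conically; a conduit of cross-section `b(ρ) × h(ρ)` carrying the flux `E₀/(2M)` (flux identity, tree
`integral_inner_eq_window_energy`) across EVERY plane must rise to `+∞`: `∫ dρ/(b·h) = ∞`; the multiplier is the only momentum source
(unforced `ΔV` is harmonic modulo `∇p` and cannot self-confine), so confinement costs `∫ (1/b² + 1/h²) dρ < ∞`; AM–GM
`1/(bh) ≤ (1/b² + 1/h²)/2` — contradiction.  (S5) FLAT is NOT killed by linear potential theory alone (a zero-total multiplier with
ultra-fat tail, atoms `a_k = 1/(k log²k)` at `|y_k| = 2^k`, gives infinite slabs in the linear model); the plan is the TAIL RENEWAL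
inequality from the sign law (`μ(|y| > 16r) ≲ Σ_j 2^{-j} μ-moments inside r` ⇒ power tail ⇒ finite slabs), which needs two explicit
KERNEL CONSTANTS of `𝒰_ξξ` — the line's cheapest falsifier; `stub_slabsFinite` is filed as the honest residual (= K1b's N9′).

STUBS (5; sorries only here): `stub_slabsFinite` (C · residue ⇒ ¬FLAT · L · residual, plan S1+S2+renewal),
`stub_annularDecayOfJet` (A · residue ∧ JET ⇒ annular decay · M · plan S1 + proved `b = 0` + potential estimates),
`stub_noConduitJet` (B · residue ∧ JET ∧ annular decay ⇒ False · L · plan S4), and line B's `stub_extremalPersistenceCompactness` (K2)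
and `stub_analyticSlices` (K1a) restated VERBATIM (shared stubs; same statements as `Lines/extremiser_liouville.lean` v1.3).
PROVED HERE: `noJetObject_of` (C, A, B ⇒ the residue hypothesis `hres` of the tree theorem, verbatim), `noAnalyticExtremal` (= K1b, via
the tree theorem), `extremalAncient_false_of` and the composition `NearExtremalTransience_of` (line B's, kernel-checked, concluding the
crux BY NAME).

WHAT THIS IS NOT.  Nothing here proves K1b, the crux, or Navier–Stokes regularity; no summit is proved by a line.  The composition is
line B's; the new content is the decomposition of K1b's residue into (C)(A)(B) and the mechanisms S1–S5 recorded in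
`Lines/kernel_budget.md`. [folklore]
-/

noncomputable section

open Set MeasureTheory Filter Topology
open scoped InnerProductSpace RealInnerProductSpace ENNReal

namespace Summit.NavierStokesRegularity.NavierStokesRegularity.Cruxes.NearExtremalTransience.KernelBudget

open Summit.NavierStokesRegularity.NavierStokesRegularity.Theses.ExtremiserTransience
open Summit.NavierStokesRegularity.NavierStokesRegularity.Theorems
open Summit.NavierStokesRegularity.NavierStokesRegularity.Theorems.DepletionLadder

set_option linter.unusedVariables false
set_option linter.dupNamespace false
set_option linter.style.longLine false

/-! ## The three new stubs on K1b's residue object (binders = the hypotheses of `stub_noAnalyticExtremal_of_noJetObject`, verbatim) -/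

namespace Sig

/-- Signature of stub C (`stub_slabsFinite`): the residue object is not FLAT (verbatim statement; binders = `hres` of
`Theorems.ExtremiserLiouville.stub_noAnalyticExtremal_of_noJetObject`). -/
def StubC : Prop :=
    ∀ (w : EuclideanSpace ℝ (Fin 3) → EuclideanSpace ℝ (Fin 3)) (c : EuclideanSpace ℝ (Fin 3)) (M : ℝ), AnalyticOnNhd ℝ w Set.univ → ContDiff ℝ (⊤ : ℕ∞) w → Literature.Analysis.FluidPDE.VectorCalculus.IsDivFree w → (∃ B : ℝ, ∀ x, ‖fderiv ℝ w x‖ ≤ B) → (∫⁻ x, ‖iteratedFDeriv ℝ 1 w x‖ₑ ^ 2 < ⊤) → (∫⁻ x, ‖iteratedFDeriv ℝ 2 w x‖ₑ ^ 2 < ⊤) → (∀ x, ‖w x‖ = M) → ‖c‖ = M → Filter.Tendsto (fun x => w x - c) (Filter.cocompact (EuclideanSpace ℝ (Fin 3))) (nhds 0) → 0 < M * Real.sqrt (∫ x, ‖Literature.Analysis.FluidPDE.curl w x‖ ^ 2) * Real.sqrt (∫ x, Literature.Analysis.FluidPDE.frobeniusNormSq (fderiv ℝ (Literature.Analysis.FluidPDE.curl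 w) x)) → (sInf {κ : ℝ | (∀ (v : EuclideanSpace ℝ (Fin 3) → EuclideanSpace ℝ (Fin 3)) (M B : ℝ), ContDiff ℝ (⊤ : ℕ∞) v → Literature.Analysis.FluidPDE.VectorCalculus.IsDivFree v → (∀ x, ‖v x‖ ≤ M) → (∀ x, ‖fderiv ℝ v x‖ ≤ B) → (∫⁻ x, ‖iteratedFDeriv ℝ 0 v x‖ₑ ^ 2 < ⊤) → (∫⁻ x, ‖iteratedFDeriv ℝ 1 v x‖ₑ ^ 2 < ⊤) → (∫⁻ x, ‖iteratedFDeriv ℝ 2 v x‖ₑ ^ 2 < ⊤) → |∫ x, ⟪Literature.Analysis.FluidPDE.curl v x, fderiv ℝ v x (Literature.Analysis.FluidPDE.curl v x)⟫_ℝ| ≤ κ * M * Real.sqrt (∫ x, ‖Literature.Analysis.FluidPDE.curl v x‖ ^ 2) * Real.sqrt (∫ x, Literature.Analysis.FluidPDE.frobeniusNormSq (fderiv ℝ (Literature.Analysis.FluidPDE.curl v) x)))}) * M * Real.sqrt (∫ x, ‖Literature.Analysis.FluidPDE.curl w x‖ ^ 2) * Real.sqrt (∫ x, Literature.Analysis.FluidPDE.frobeniusNormSq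 (fderiv ℝ (Literature.Analysis.FluidPDE.curl w) x)) = |∫ x, ⟪Literature.Analysis.FluidPDE.curl w x, fderiv ℝ w x (Literature.Analysis.FluidPDE.curl w x)⟫_ℝ| →
      ¬ (∃ T : ℝ, 0 < T ∧ ¬ Integrable (fun x => {x : EuclideanSpace ℝ (Fin 3) | |⟪x, c⟫_ℝ| / ‖c‖ ≤ T}.indicator (fun x => ‖w x - c‖ ^ 2) x) volume)

/-- Signature of stub A (`stub_annularDecayOfJet`): a residue JET has `o(r)` annular energies. -/
def StubA : Prop :=
    ∀ (w : EuclideanSpace ℝ (Fin 3) → EuclideanSpace ℝ (Fin 3)) (c : EuclideanSpace ℝ (Fin 3)) (M : ℝ), AnalyticOnNhd ℝ w Set.univ → ContDiff ℝ (⊤ : ℕ∞) w → Literature.Analysis.FluidPDE.VectorCalculus.IsDivFree w → (∃ B : ℝ, ∀ x, ‖fderiv ℝ w x‖ ≤ B) → (∫⁻ x, ‖iteratedFDeriv ℝ 1 w x‖ₑ ^ 2 < ⊤) → (∫⁻ x, ‖iteratedFDeriv ℝ 2 w x‖ₑ ^ 2 < ⊤) → (∀ x, ‖w x‖ = M) →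 ‖c‖ = M → Filter.Tendsto (fun x => w x - c) (Filter.cocompact (EuclideanSpace ℝ (Fin 3))) (nhds 0) → 0 < M * Real.sqrt (∫ x, ‖Literature.Analysis.FluidPDE.curl w x‖ ^ 2) * Real.sqrt (∫ x, Literature.Analysis.FluidPDE.frobeniusNormSq (fderiv ℝ (Literature.Analysis.FluidPDE.curl w) x)) → (sInf {κ : ℝ | (∀ (v : EuclideanSpace ℝ (Fin 3) → EuclideanSpace ℝ (Fin 3)) (M B : ℝ), ContDiff ℝ (⊤ : ℕ∞) v → Literature.Analysis.FluidPDE.VectorCalculus.IsDivFree v → (∀ x, ‖v x‖ ≤ M) → (∀ x, ‖fderiv ℝ v x‖ ≤ B) → (∫⁻ x, ‖iteratedFDeriv ℝ 0 v x‖ₑ ^ 2 < ⊤) → (∫⁻ x, ‖iteratedFDeriv ℝ 1 v x‖ₑ ^ 2 < ⊤) → (∫⁻ x, ‖iteratedFDeriv ℝ 2 v x‖ₑ ^ 2 < ⊤) → |∫ x, ⟪Literature.Analysis.FluidPDE.curl v x, fderiv ℝ v x (Literature.Analysis.FluidPDE.curl v x)⟫_ℝ| ≤ κ * M * Real.sqrt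 (∫ x, ‖Literature.Analysis.FluidPDE.curl v x‖ ^ 2) * Real.sqrt (∫ x, Literature.Analysis.FluidPDE.frobeniusNormSq (fderiv ℝ (Literature.Analysis.FluidPDE.curl v) x)))}) * M * Real.sqrt (∫ x, ‖Literature.Analysis.FluidPDE.curl w x‖ ^ 2) * Real.sqrt (∫ x, Literature.Analysis.FluidPDE.frobeniusNormSq (fderiv ℝ (Literature.Analysis.FluidPDE.curl w) x)) = |∫ x, ⟪Literature.Analysis.FluidPDE.curl w x, fderiv ℝ w x (Literature.Analysis.FluidPDE.curl w x)⟫_ℝ| →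
      ((∀ T : ℝ, 0 < T → Integrable (fun x => {x : EuclideanSpace ℝ (Fin 3) | |⟪x, c⟫_ℝ| / ‖c‖ ≤ T}.indicator (fun x => ‖w x - c‖ ^ 2) x) volume) ∧ ∃ E₀ : ℝ, 0 < E₀ ∧ ∀ s : ℝ, (∫ x, deriv Real.smoothTransition (⟪x, c⟫_ℝ / ‖c‖ - s) * ‖w x - c‖ ^ 2) = E₀) →
      (Filter.Tendsto (fun r : ℝ => r⁻¹ * ∫ x in {x : EuclideanSpace ℝ (Fin 3) | r < ‖x‖ ∧ ‖x‖ < 2 * r}, ‖w x - c‖ ^ 2) Filter.atTop (nhds 0))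

/-- Signature of stub B (`stub_noConduitJet`): a residue JET with `o(r)` annular energies does not exist. -/
def StubB : Prop :=
    ∀ (w : EuclideanSpace ℝ (Fin 3) → EuclideanSpace ℝ (Fin 3)) (c : EuclideanSpace ℝ (Fin 3)) (M : ℝ), AnalyticOnNhd ℝ w Set.univ → ContDiff ℝ (⊤ : ℕ∞) w → Literature.Analysis.FluidPDE.VectorCalculus.IsDivFree w → (∃ B : ℝ, ∀ x, ‖fderiv ℝ w x‖ ≤ B) → (∫⁻ x, ‖iteratedFDeriv ℝ 1 w x‖ₑ ^ 2 < ⊤) → (∫⁻ x, ‖iteratedFDeriv ℝ 2 w x‖ₑ ^ 2 < ⊤) → (∀ x, ‖w x‖ = M) → ‖c‖ = M → Filter.Tendsto (fun x => w x - c) (Filter.cocompact (EuclideanSpace ℝ (Fin 3))) (nhds 0) → 0 < M * Real.sqrt (∫ x, ‖Literature.Analysis.FluidPDE.curl w x‖ ^ 2) * Real.sqrt (∫ x, Literature.Analysis.FluidPDE.frobeniusNormSq (fderiv ℝ (Literature.Analysis.FluidPDE.curl w) x)) → (sInf {κ : ℝ | (∀ (v : EuclideanSpace ℝ (Fin 3)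 → EuclideanSpace ℝ (Fin 3)) (M B : ℝ), ContDiff ℝ (⊤ : ℕ∞) v → Literature.Analysis.FluidPDE.VectorCalculus.IsDivFree v → (∀ x, ‖v x‖ ≤ M) → (∀ x, ‖fderiv ℝ v x‖ ≤ B) → (∫⁻ x, ‖iteratedFDeriv ℝ 0 v x‖ₑ ^ 2 < ⊤) → (∫⁻ x, ‖iteratedFDeriv ℝ 1 v x‖ₑ ^ 2 < ⊤) → (∫⁻ x, ‖iteratedFDeriv ℝ 2 v x‖ₑ ^ 2 < ⊤) → |∫ x, ⟪Literature.Analysis.FluidPDE.curl v x, fderiv ℝ v x (Literature.Analysis.FluidPDE.curl v x)⟫_ℝ| ≤ κ * M * Real.sqrt (∫ x, ‖Literature.Analysis.FluidPDE.curl v x‖ ^ 2) * Real.sqrt (∫ x, Literature.Analysis.FluidPDE.frobeniusNormSq (fderiv ℝ (Literature.Analysis.FluidPDE.curl v) x)))}) * M * Real.sqrt (∫ x, ‖Literature.Analysis.FluidPDE.curl w x‖ ^ 2) * Real.sqrt (∫ x, Literature.Analysis.FluidPDE.frobeniusNormSq (fderiv ℝ (Literature.Analysis.FluidPDE.curl w)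 x)) = |∫ x, ⟪Literature.Analysis.FluidPDE.curl w x, fderiv ℝ w x (Literature.Analysis.FluidPDE.curl w x)⟫_ℝ| →
      ((∀ T : ℝ, 0 < T → Integrable (fun x => {x : EuclideanSpace ℝ (Fin 3) | |⟪x, c⟫_ℝ| / ‖c‖ ≤ T}.indicator (fun x => ‖w x - c‖ ^ 2) x) volume) ∧ ∃ E₀ : ℝ, 0 < E₀ ∧ ∀ s : ℝ, (∫ x, deriv Real.smoothTransition (⟪x, c⟫_ℝ / ‖c‖ - s) * ‖w x - c‖ ^ 2) = E₀) →
      (Filter.Tendsto (fun r : ℝ => r⁻¹ * ∫ x in {x : EuclideanSpace ℝ (Fin 3) | r < ‖x‖ ∧ ‖x‖ < 2 * r}, ‖w x - c‖ ^ 2) Filter.atTop (nhds 0)) → False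

end Sig

/-- **C · stub_slabsFinite (residual, L).**  The residue object is NOT FLAT: every slab `{|ξ| ≤ T}` carries finite energy `∫‖w − c‖²`.
Plan (card §S1, §S2, §S2′): representation `V = −𝒰∗(vμ) + S∇𝒰∗τ`; no drag `b = 0` from the sign law `V_ξ ≤ 0`; tail renewal
`μ(|y| > 16r) ≲ Σ_j 2^{-j}·(μ-mass at scale 2^{-j}r) + q_r` ⇒ power tail ⇒ finite slabs.  Why it might fail: the renewal needs two
kernel constants of `𝒰_ξξ` (annular-average maximality at the centre; dipole constant) — unfavourable constants leave FLAT to K1b's N9′.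
Shared residual with line B / K1b (N9′). [folklore] -/
theorem stub_slabsFinite : Sig.StubC := by
  sorry

/-- **A · stub_annularDecayOfJet (M).**  For the residue JET the annular energies are `o(r)`: `r⁻¹∫_{r<|x|<2r}‖w − c‖² → 0`
(strong `L²_loc(ℝ³∖0)` vanishing of the degree-(−1) blow-downs `V_R = R·(w − c)(R·)`).  Plan (card §S1, §S3): representation by the
explicit kernel `𝒰` of `κ⋆²M²(ZΔ² − WΔ)∘ℙ`; `b = ∫v dμ = 0` is the tree theorem `integral_eq_zero_of_jet`; then dominated convergence
(core dipole), Minkowski (shell mass `μ(r/8 ≤ |y| ≤ 16r) → 0`), far tail, and HLS with `‖curl w‖_{L²(A_r)} → 0` for the quadratic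
term.  Why it might fail: the tempered-Liouville step needs `𝒰∗(vμ)` and `∇𝒰∗τ` bounded and vanishing at infinity (true for finite μ and
τ ∈ L¹ since `𝒰`, `∇𝒰` are bounded — to be checked against the exact kernel). [folklore] -/
theorem stub_annularDecayOfJet : Sig.StubA := by
  sorry

/-- **B · stub_noConduitJet (L; the new load-bearing stub).**  A residue JET with `o(r)` annular energies does not exist.  Plan (card
§S4): (S3) forces the window energy at height `s` to sit at horizontal distance `L(s) ≫ |s|` (super-conical escape); the flux identity
(`∫_{plane} V_ξ = −E₀/(2M)`, tree) + incompressibility make the energy-carrying set a conduit of cross-section `b(ρ)×h(ρ)` whose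
height `σ(ρ)` obeys `σ' = E₀/(4M²·b·h)` and must diverge (`∫dρ/(bh) = ∞`, every plane is crossed); the finite multiplier mass is the
only momentum source (off `supp μ`, `ΔV` is harmonic modulo a gradient and cannot confine a thin layer), costing `∫(1/b² + 1/h²)dρ < ∞`;
AM–GM contradicts.  Why it might fail: the "cannot self-confine" step is a unique-continuation / three-spheres statement for the
fourth-order Stokes–Brinkman system that is heuristic as written; a diffuse (non-conduit) super-conical energy distribution must be
shown to cost MORE, not less. [folklore] -/
theorem stub_noConduitJet : Sig.StubB := by
  sorry

/-- **PROVED: the residue hypothesis `hres` of `Theorems.ExtremiserLiouville.stub_noAnalyticExtremal_of_noJetObject`** from the three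
stubs (flat ↦ C; jet ↦ A then B).  Statement verbatim = that hypothesis. -/
theorem noJetObject_of (hC : Sig.StubC) (hA : Sig.StubA) (hB : Sig.StubB) :
    ∀ (w : EuclideanSpace ℝ (Fin 3) → EuclideanSpace ℝ (Fin 3)) (c : EuclideanSpace ℝ (Fin 3)) (M : ℝ), AnalyticOnNhd ℝ w Set.univ → ContDiff ℝ (⊤ : ℕ∞) w → Literature.Analysis.FluidPDE.VectorCalculus.IsDivFree w → (∃ B : ℝ, ∀ x, ‖fderiv ℝ w x‖ ≤ B) → (∫⁻ x, ‖iteratedFDeriv ℝ 1 w x‖ₑ ^ 2 < ⊤) → (∫⁻ x, ‖iteratedFDeriv ℝ 2 w x‖ₑ ^ 2 < ⊤) → (∀ x, ‖w x‖ = M) → ‖c‖ = M → Filter.Tendsto (fun x => w x - c) (Filter.cocompact (EuclideanSpace ℝ (Fin 3))) (nhds 0) → 0 < M * Real.sqrt (∫ x, ‖Literature.Analysis.FluidPDE.curl w x‖ ^ 2) * Real.sqrt (∫ x, Literature.Analysis.FluidPDE.frobeniusNormSq (fderiv ℝ (Literature.Analysis.FluidPDE.curl w) x)) → (sInf {κ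 : ℝ | (∀ (v : EuclideanSpace ℝ (Fin 3) → EuclideanSpace ℝ (Fin 3)) (M B : ℝ), ContDiff ℝ (⊤ : ℕ∞) v → Literature.Analysis.FluidPDE.VectorCalculus.IsDivFree v → (∀ x, ‖v x‖ ≤ M) → (∀ x, ‖fderiv ℝ v x‖ ≤ B) → (∫⁻ x, ‖iteratedFDeriv ℝ 0 v x‖ₑ ^ 2 < ⊤) → (∫⁻ x, ‖iteratedFDeriv ℝ 1 v x‖ₑ ^ 2 < ⊤) → (∫⁻ x, ‖iteratedFDeriv ℝ 2 v x‖ₑ ^ 2 < ⊤) → |∫ x, ⟪Literature.Analysis.FluidPDE.curl v x, fderiv ℝ v x (Literature.Analysis.FluidPDE.curl v x)⟫_ℝ| ≤ κ * M * Real.sqrt (∫ x, ‖Literature.Analysis.FluidPDE.curl v x‖ ^ 2) * Real.sqrt (∫ x, Literature.Analysis.FluidPDE.frobeniusNormSq (fderiv ℝ (Literature.Analysis.FluidPDE.curl v) x)))}) * M * Real.sqrt (∫ x, ‖Literature.Analysis.FluidPDE.curl w x‖ ^ 2) * Real.sqrt (∫ x, Literature.Analysis.FluidPDE.frobeniusNormSq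 (fderiv ℝ (Literature.Analysis.FluidPDE.curl w) x)) = |∫ x, ⟪Literature.Analysis.FluidPDE.curl w x, fderiv ℝ w x (Literature.Analysis.FluidPDE.curl w x)⟫_ℝ| →
      ¬ ((∃ T : ℝ, 0 < T ∧ ¬ Integrable (fun x => {x : EuclideanSpace ℝ (Fin 3) | |⟪x, c⟫_ℝ| / ‖c‖ ≤ T}.indicator (fun x => ‖w x - c‖ ^ 2) x) volume) ∨ ((∀ T : ℝ, 0 < T → Integrable (fun x => {x : EuclideanSpace ℝ (Fin 3) | |⟪x, c⟫_ℝ| / ‖c‖ ≤ T}.indicator (fun x => ‖w x - c‖ ^ 2) x) volume) ∧ ∃ E₀ : ℝ, 0 < E₀ ∧ ∀ s : ℝ, (∫ x, deriv Real.smoothTransition (⟪x, c⟫_ℝ / ‖c‖ - s) * ‖w x - c‖ ^ 2) = E₀)) := by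
  intro w c M han hcd hdiv hbd h1 h2 hM hcM hfar hpos hext hor
  rcases hor with hflat | hjet
  · exact hC w c M han hcd hdiv hbd h1 h2 hM hcM hfar hpos hext hflat
  · exact hB w c M han hcd hdiv hbd h1 h2 hM hcM hfar hpos hext hjet (hA w c M han hcd hdiv hbd h1 h2 hM hcM hfar hpos hext hjet)

/-- **PROVED (modulo the stubs C, A, B): K1b — line B's `stub_noAnalyticExtremal`, statement verbatim**, via the K1b seat's tree
theorem `stub_noAnalyticExtremal_of_noJetObject` (…ConstantSpeedEnergyFluxJet). -/
theorem noAnalyticExtremal :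
    ¬ ∃ (w : EuclideanSpace ℝ (Fin 3) → EuclideanSpace ℝ (Fin 3)), AnalyticOnNhd ℝ w Set.univ ∧ (ContDiff ℝ (⊤ : ℕ∞) w ∧ Literature.Analysis.FluidPDE.VectorCalculus.IsDivFree w ∧ (∃ B : ℝ, ∀ x, ‖fderiv ℝ w x‖ ≤ B) ∧ (∫⁻ x, ‖iteratedFDeriv ℝ 1 w x‖ₑ ^ 2 < ⊤) ∧ (∫⁻ x, ‖iteratedFDeriv ℝ 2 w x‖ₑ ^ 2 < ⊤) ∧ ∃ M : ℝ, (∀ x, ‖w x‖ ≤ M) ∧ 0 < M * Real.sqrt (∫ x, ‖Literature.Analysis.FluidPDE.curl w x‖ ^ 2) * Real.sqrt (∫ x, Literature.Analysis.FluidPDE.frobeniusNormSq (fderiv ℝ (Literature.Analysis.FluidPDE.curl w) x)) ∧ (sInf {κ : ℝ | (∀ (v : EuclideanSpace ℝ (Fin 3) → EuclideanSpace ℝ (Fin 3)) (M B : ℝ), ContDiff ℝ (⊤ : ℕ∞) v → Literature.Analysis.FluidPDE.VectorCalculus.IsDivFree v → (∀ x, ‖v x‖ ≤ M) → (∀ x,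 ‖fderiv ℝ v x‖ ≤ B) → (∫⁻ x, ‖iteratedFDeriv ℝ 0 v x‖ₑ ^ 2 < ⊤) → (∫⁻ x, ‖iteratedFDeriv ℝ 1 v x‖ₑ ^ 2 < ⊤) → (∫⁻ x, ‖iteratedFDeriv ℝ 2 v x‖ₑ ^ 2 < ⊤) → |∫ x, ⟪Literature.Analysis.FluidPDE.curl v x, fderiv ℝ v x (Literature.Analysis.FluidPDE.curl v x)⟫_ℝ| ≤ κ * M * Real.sqrt (∫ x, ‖Literature.Analysis.FluidPDE.curl v x‖ ^ 2) * Real.sqrt (∫ x, Literature.Analysis.FluidPDE.frobeniusNormSq (fderiv ℝ (Literature.Analysis.FluidPDE.curl v) x)))}) * M * Real.sqrt (∫ x, ‖Literature.Analysis.FluidPDE.curl w x‖ ^ 2) * Real.sqrt (∫ x, Literature.Analysis.FluidPDE.frobeniusNormSq (fderiv ℝ (Literature.Analysis.FluidPDE.curl w) x)) ≤ |∫ x, ⟪Literature.Analysis.FluidPDE.curl w x, fderiv ℝ w x (Literature.Analysis.FluidPDE.curl w x)⟫_ℝ|) :=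
  ExtremiserLiouville.stub_noAnalyticExtremal_of_noJetObject (noJetObject_of stub_slabsFinite stub_annularDecayOfJet stub_noConduitJet)

/-! ## Line B's stubs K2, K1a (restated verbatim — shared), its rigidity lemma and its kernel-checked composition -/

/-- **K2 · stub_extremalPersistenceCompactness (crux of the line, XL; the load-bearing stub).**  PERSISTENCE COMPACTIFIES:
if near-extremal stretching persists in windowed log-time mean at levels β ↑ κ⋆² on windows of unbounded log-length along
Type-I singular flows (the scenario P of the module docstring), then an extremal ancient solution exists (module docstring).
Mechanism (card §Stubs): choose β_n ↑ κ⋆², L_n ↑ ∞, flows u_n and windows; centre at an efficient time t_n near the argmax of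
the Leray number m(t) = ‖u(t)‖∞√(T−t)/√ν over the window (so the KNSS-rescaled flow is bounded by 2 backward, whatever the
Type-I constant C_n), at a point of the heavy near-extremal piece; SCALE LOCK: in a near-extremal window with the enstrophy
keeping Leray's pace, the dissipation length ℓ = √(Z/P) is comparable to the parabolic length √(ν(T−t)) on a set of times of
positive log-density (d log Z/ds ≤ 2κ⋆m/ℓ̃ − 2/ℓ̃², ℓ̃ = ℓ/√(ν(T−t)), forces ℓ̃ ∈ [2κ⋆m ∓ 2√(κ⋆²m²−1)] where Z grows), so
the rescaled viscosity stays 1 and the efficient structure lives at the parabolic scale; KNSS C^∞_loc compactness of bounded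
Oseen-mild sequences (tree `isKNSSBlowupLimit_of_oseenMild_zoom`, `KNSS2009_lemma61_*`) gives the limit W in the Oseen
gauge; TIGHTNESS of near-maximisers of R (splitting far-apart pieces is R-neutral only at equal amplitude and equal Z/P
ratio — Cauchy–Schwarz — so every heavy piece of a near-extremal field is near-extremal) and Fatou on the followed piece give
extremal slices for a.e. time of an interval around the centring time.
Why it might fail: loss of tightness (the efficient structure at time t and at time t' are different structures escaping to
infinity from each other in rescaled units — then only one instant survives); or the followed piece loses finite (Z,P) in the
limit (enstrophy spread over ≫ parabolic scales); or near-extremal windows realise their mean by SHORT bursts at scales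
≪ parabolic (ℓ̃ → 0 on the efficient set, Euler scaling) — the scale-lock inequality bounds this only where Z grows. -/
theorem stub_extremalPersistenceCompactness :
    (∀ β : ℝ, β < (sInf {κ : ℝ | (∀ (v : EuclideanSpace ℝ (Fin 3) → EuclideanSpace ℝ (Fin 3)) (M B : ℝ), ContDiff ℝ (⊤ : ℕ∞) v → Literature.Analysis.FluidPDE.VectorCalculus.IsDivFree v → (∀ x, ‖v x‖ ≤ M) → (∀ x, ‖fderiv ℝ v x‖ ≤ B) → (∫⁻ x, ‖iteratedFDeriv ℝ 0 v x‖ₑ ^ 2 < ⊤) → (∫⁻ x, ‖iteratedFDeriv ℝ 1 v x‖ₑ ^ 2 < ⊤) → (∫⁻ x, ‖iteratedFDeriv ℝ 2 v x‖ₑ ^ 2 < ⊤) → |∫ x, ⟪Literature.Analysis.FluidPDE.curl v x, fderiv ℝ v x (Literature.Analysis.FluidPDE.curl v x)⟫_ℝ| ≤ κ * M * Real.sqrt (∫ x, ‖Literature.Analysis.FluidPDE.curl v x‖ ^ 2) * Real.sqrt (∫ x, Literature.Analysis.FluidPDE.frobeniusNormSq (fderiv ℝ (Literature.Analysis.FluidPDE.curl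 v) x)))}) ^ 2 → ∀ L : ℝ, 0 < L → ∃ (C ν T : ℝ) (u : ℝ → EuclideanSpace ℝ (Fin 3) → EuclideanSpace ℝ (Fin 3)) (p : ℝ → EuclideanSpace ℝ (Fin 3) → ℝ), 0 < C ∧ 0 < ν ∧ 0 < T ∧ Literature.Analysis.FluidPDE.IsClassicalNSSolutionOn (Set.Ico 0 T) ν 0 u p ∧ Literature.Analysis.FluidPDE.IsLerayHopfOn T ν 0 (u 0) u ∧ Literature.Analysis.FluidPDE.HasRapidSpatialDecay (u 0) ∧ (∀ᶠ t in 𝓝[<] T, ∀ x, Real.sqrt (T - t) * ‖u t x‖ ≤ C * Real.sqrt ν) ∧ ¬ Literature.Analysis.FluidPDE.HasSmoothExtensionPast ν 0 u T ∧ ∀ (k : ℝ → ℝ), Measurable k → (∀ τ, 0 ≤ k τ ∧ k τ ≤ 1) → (∀ t ∈ Set.Ico 0 T, ∀ M : ℝ, (∀ x, ‖u t x‖ ≤ M) → |∫ x, ⟪Literature.Analysis.FluidPDE.curl (u t) x, fderiv ℝ (u t) x (Literature.Analysis.FluidPDE.curl (u t) x)⟫_ℝ| ≤ k t * M * Real.sqrt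 (∫ x, ‖Literature.Analysis.FluidPDE.curl (u t) x‖ ^ 2) * Real.sqrt (∫ x, Literature.Analysis.FluidPDE.frobeniusNormSq (fderiv ℝ (Literature.Analysis.FluidPDE.curl (u t)) x))) → ∀ t₁ ∈ Set.Ico 0 T, ∃ s₁ s₂ : ℝ, t₁ ≤ s₁ ∧ s₁ < s₂ ∧ s₂ < T ∧ L ≤ Real.log ((T - s₁) / (T - s₂)) ∧ β * Real.log ((T - s₁) / (T - s₂)) < ∫ τ in s₁..s₂, k τ ^ 2 / (T - τ)) → ∃ (W : ℝ → EuclideanSpace ℝ (Fin 3) → EuclideanSpace ℝ (Fin 3)) (a b : ℝ), (Literature.Analysis.FluidPDE.IsKNSSBlowupLimit W ∧ (∀ s t : ℝ, s < t → t < 0 → ∀ x, W t x = Literature.Analysis.FluidPDE.heatFlow (W s) (t - s) x - Literature.Analysis.FluidPDE.oseenDuhamel 1 s W W t x)) ∧ a < b ∧ b ≤ 0 ∧ ∀ᵐ t : ℝ, t ∈ Set.Ioo a b → (ContDiff ℝ (⊤ : ℕ∞) (W t) ∧ Literature.Analysis.FluidPDE.VectorCalculus.IsDivFree (W t) ∧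 (∃ B : ℝ, ∀ x, ‖fderiv ℝ (W t) x‖ ≤ B) ∧ (∫⁻ x, ‖iteratedFDeriv ℝ 1 (W t) x‖ₑ ^ 2 < ⊤) ∧ (∫⁻ x, ‖iteratedFDeriv ℝ 2 (W t) x‖ₑ ^ 2 < ⊤) ∧ ∃ M : ℝ, (∀ x, ‖(W t) x‖ ≤ M) ∧ 0 < M * Real.sqrt (∫ x, ‖Literature.Analysis.FluidPDE.curl (W t) x‖ ^ 2) * Real.sqrt (∫ x, Literature.Analysis.FluidPDE.frobeniusNormSq (fderiv ℝ (Literature.Analysis.FluidPDE.curl (W t)) x)) ∧ (sInf {κ : ℝ | (∀ (v : EuclideanSpace ℝ (Fin 3) → EuclideanSpace ℝ (Fin 3)) (M B : ℝ), ContDiff ℝ (⊤ : ℕ∞) v → Literature.Analysis.FluidPDE.VectorCalculus.IsDivFree v → (∀ x, ‖v x‖ ≤ M) → (∀ x, ‖fderiv ℝ v x‖ ≤ B) → (∫⁻ x, ‖iteratedFDeriv ℝ 0 v x‖ₑ ^ 2 < ⊤) → (∫⁻ x, ‖iteratedFDeriv ℝ 1 v x‖ₑ ^ 2 < ⊤)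 → (∫⁻ x, ‖iteratedFDeriv ℝ 2 v x‖ₑ ^ 2 < ⊤) → |∫ x, ⟪Literature.Analysis.FluidPDE.curl v x, fderiv ℝ v x (Literature.Analysis.FluidPDE.curl v x)⟫_ℝ| ≤ κ * M * Real.sqrt (∫ x, ‖Literature.Analysis.FluidPDE.curl v x‖ ^ 2) * Real.sqrt (∫ x, Literature.Analysis.FluidPDE.frobeniusNormSq (fderiv ℝ (Literature.Analysis.FluidPDE.curl v) x)))}) * M * Real.sqrt (∫ x, ‖Literature.Analysis.FluidPDE.curl (W t) x‖ ^ 2) * Real.sqrt (∫ x, Literature.Analysis.FluidPDE.frobeniusNormSq (fderiv ℝ (Literature.Analysis.FluidPDE.curl (W t)) x)) ≤ |∫ x, ⟪Literature.Analysis.FluidPDE.curl (W t) x, fderiv ℝ (W t) x (Literature.Analysis.FluidPDE.curl (W t) x)⟫_ℝ|) := by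
  sorry

/-- **K1a · stub_analyticSlices (support-sized stub, M/L; a known mechanism to be landed).**  Slices of a KNSS blow-up limit in
the Oseen gauge are REAL-ANALYTIC in space at every negative time (KNSS 2009 §4: bounded mild solutions are C^∞ with bounds;
spatial analyticity of mild solutions with bounded data by the complex Picard/Oseen scheme — Masuda 1967, Giga–Sawada 2003,
Dong–Li; tree: `Literature.Analysis.FluidPDE.OseenSchemeRealAnalytic` (real boosts of the complex Oseen scheme) and
`typeI_mild_analyticOnNhd` for the Type-I ancient class — the bounded class runs the same scheme on a unit window).
Why it might fail: it should not; the only work is running the tree's complex Oseen scheme from bounded (not decaying) data. -/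
theorem stub_analyticSlices :
    ∀ (W : ℝ → EuclideanSpace ℝ (Fin 3) → EuclideanSpace ℝ (Fin 3)), (Literature.Analysis.FluidPDE.IsKNSSBlowupLimit W ∧ (∀ s t : ℝ, s < t → t < 0 → ∀ x, W t x = Literature.Analysis.FluidPDE.heatFlow (W s) (t - s) x - Literature.Analysis.FluidPDE.oseenDuhamel 1 s W W t x)) → ∀ t : ℝ, t < 0 → AnalyticOnNhd ℝ (W t) Set.univ := by
  sorry


/-- **Rigidity, dynamic form (PROVED from K1a, K1b): no extremal ancient solution exists.**  From a.e.-extremality on a time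
interval of positive length pick one extremal time t < 0 (`ae_iff`, `Real.volume_Ioo`), read off the extremal slice, and hand
the analytic (K1a) extremal field W(t) to K1b. -/
theorem extremalAncient_false_of
    (h1a : ∀ (W : ℝ → EuclideanSpace ℝ (Fin 3) → EuclideanSpace ℝ (Fin 3)), (Literature.Analysis.FluidPDE.IsKNSSBlowupLimit W ∧ (∀ s t : ℝ, s < t → t < 0 → ∀ x, W t x = Literature.Analysis.FluidPDE.heatFlow (W s) (t - s) x - Literature.Analysis.FluidPDE.oseenDuhamel 1 s W W t x)) → ∀ t : ℝ, t < 0 → AnalyticOnNhd ℝ (W t) Set.univ)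
    (h1b : ¬ ∃ (w : EuclideanSpace ℝ (Fin 3) → EuclideanSpace ℝ (Fin 3)), AnalyticOnNhd ℝ w Set.univ ∧ (ContDiff ℝ (⊤ : ℕ∞) w ∧ Literature.Analysis.FluidPDE.VectorCalculus.IsDivFree w ∧ (∃ B : ℝ, ∀ x, ‖fderiv ℝ w x‖ ≤ B) ∧ (∫⁻ x, ‖iteratedFDeriv ℝ 1 w x‖ₑ ^ 2 < ⊤) ∧ (∫⁻ x, ‖iteratedFDeriv ℝ 2 w x‖ₑ ^ 2 < ⊤) ∧ ∃ M : ℝ, (∀ x, ‖w x‖ ≤ M) ∧ 0 < M * Real.sqrt (∫ x, ‖Literature.Analysis.FluidPDE.curl w x‖ ^ 2) * Real.sqrt (∫ x, Literature.Analysis.FluidPDE.frobeniusNormSq (fderiv ℝ (Literature.Analysis.FluidPDE.curl w) x)) ∧ (sInf {κ : ℝ | (∀ (v : EuclideanSpace ℝ (Fin 3) → EuclideanSpace ℝ (Fin 3)) (M B : ℝ), ContDiff ℝ (⊤ : ℕ∞) v → Literature.Analysis.FluidPDE.VectorCalculus.IsDivFree v → (∀ x, ‖v x‖ ≤ M) →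 (∀ x, ‖fderiv ℝ v x‖ ≤ B) → (∫⁻ x, ‖iteratedFDeriv ℝ 0 v x‖ₑ ^ 2 < ⊤) → (∫⁻ x, ‖iteratedFDeriv ℝ 1 v x‖ₑ ^ 2 < ⊤) → (∫⁻ x, ‖iteratedFDeriv ℝ 2 v x‖ₑ ^ 2 < ⊤) → |∫ x, ⟪Literature.Analysis.FluidPDE.curl v x, fderiv ℝ v x (Literature.Analysis.FluidPDE.curl v x)⟫_ℝ| ≤ κ * M * Real.sqrt (∫ x, ‖Literature.Analysis.FluidPDE.curl v x‖ ^ 2) * Real.sqrt (∫ x, Literature.Analysis.FluidPDE.frobeniusNormSq (fderiv ℝ (Literature.Analysis.FluidPDE.curl v) x)))}) * M * Real.sqrt (∫ x, ‖Literature.Analysis.FluidPDE.curl w x‖ ^ 2) * Real.sqrt (∫ x, Literature.Analysis.FluidPDE.frobeniusNormSq (fderiv ℝ (Literature.Analysis.FluidPDE.curl w) x)) ≤ |∫ x, ⟪Literature.Analysis.FluidPDE.curl w x, fderiv ℝ w x (Literature.Analysis.FluidPDE.curl w x)⟫_ℝ|)) :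
    ¬ (∃ (W : ℝ → EuclideanSpace ℝ (Fin 3) → EuclideanSpace ℝ (Fin 3)) (a b : ℝ), (Literature.Analysis.FluidPDE.IsKNSSBlowupLimit W ∧ (∀ s t : ℝ, s < t → t < 0 → ∀ x, W t x = Literature.Analysis.FluidPDE.heatFlow (W s) (t - s) x - Literature.Analysis.FluidPDE.oseenDuhamel 1 s W W t x)) ∧ a < b ∧ b ≤ 0 ∧ ∀ᵐ t : ℝ, t ∈ Set.Ioo a b → (ContDiff ℝ (⊤ : ℕ∞) (W t) ∧ Literature.Analysis.FluidPDE.VectorCalculus.IsDivFree (W t) ∧ (∃ B : ℝ, ∀ x, ‖fderiv ℝ (W t) x‖ ≤ B) ∧ (∫⁻ x, ‖iteratedFDeriv ℝ 1 (W t) x‖ₑ ^ 2 < ⊤) ∧ (∫⁻ x, ‖iteratedFDeriv ℝ 2 (W t) x‖ₑ ^ 2 < ⊤) ∧ ∃ M : ℝ, (∀ x, ‖(W t) x‖ ≤ M) ∧ 0 < M * Real.sqrt (∫ x, ‖Literature.Analysis.FluidPDE.curl (W t) x‖ ^ 2) * Real.sqrt (∫ x, Literature.Analysis.FluidPDE.frobeniusNormSq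 (fderiv ℝ (Literature.Analysis.FluidPDE.curl (W t)) x)) ∧ (sInf {κ : ℝ | (∀ (v : EuclideanSpace ℝ (Fin 3) → EuclideanSpace ℝ (Fin 3)) (M B : ℝ), ContDiff ℝ (⊤ : ℕ∞) v → Literature.Analysis.FluidPDE.VectorCalculus.IsDivFree v → (∀ x, ‖v x‖ ≤ M) → (∀ x, ‖fderiv ℝ v x‖ ≤ B) → (∫⁻ x, ‖iteratedFDeriv ℝ 0 v x‖ₑ ^ 2 < ⊤) → (∫⁻ x, ‖iteratedFDeriv ℝ 1 v x‖ₑ ^ 2 < ⊤) → (∫⁻ x, ‖iteratedFDeriv ℝ 2 v x‖ₑ ^ 2 < ⊤) → |∫ x, ⟪Literature.Analysis.FluidPDE.curl v x, fderiv ℝ v x (Literature.Analysis.FluidPDE.curl v x)⟫_ℝ| ≤ κ * M * Real.sqrt (∫ x, ‖Literature.Analysis.FluidPDE.curl v x‖ ^ 2) * Real.sqrt (∫ x, Literature.Analysis.FluidPDE.frobeniusNormSq (fderiv ℝ (Literature.Analysis.FluidPDE.curl v) x)))}) * M * Real.sqrt (∫ x, ‖Literature.Analysis.FluidPDE.curl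 (W t) x‖ ^ 2) * Real.sqrt (∫ x, Literature.Analysis.FluidPDE.frobeniusNormSq (fderiv ℝ (Literature.Analysis.FluidPDE.curl (W t)) x)) ≤ |∫ x, ⟪Literature.Analysis.FluidPDE.curl (W t) x, fderiv ℝ (W t) x (Literature.Analysis.FluidPDE.curl (W t) x)⟫_ℝ|)) := by
  rintro ⟨W, a, b, hW, hab, hb0, hae⟩
  have hex : ∃ t ∈ Set.Ioo a b, (ContDiff ℝ (⊤ : ℕ∞) (W t) ∧ Literature.Analysis.FluidPDE.VectorCalculus.IsDivFree (W t) ∧ (∃ B : ℝ, ∀ x, ‖fderiv ℝ (W t) x‖ ≤ B) ∧ (∫⁻ x, ‖iteratedFDeriv ℝ 1 (W t) x‖ₑ ^ 2 < ⊤) ∧ (∫⁻ x, ‖iteratedFDeriv ℝ 2 (W t) x‖ₑ ^ 2 < ⊤) ∧ ∃ M : ℝ, (∀ x, ‖(W t) x‖ ≤ M) ∧ 0 < M * Real.sqrt (∫ x, ‖Literature.Analysis.FluidPDE.curl (W t) x‖ ^ 2) * Real.sqrt (∫ x, Literature.Analysis.FluidPDE.frobeniusNormSq (fderiv ℝ (Literature.Analysis.FluidPDE.curl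 (W t)) x)) ∧ (sInf {κ : ℝ | (∀ (v : EuclideanSpace ℝ (Fin 3) → EuclideanSpace ℝ (Fin 3)) (M B : ℝ), ContDiff ℝ (⊤ : ℕ∞) v → Literature.Analysis.FluidPDE.VectorCalculus.IsDivFree v → (∀ x, ‖v x‖ ≤ M) → (∀ x, ‖fderiv ℝ v x‖ ≤ B) → (∫⁻ x, ‖iteratedFDeriv ℝ 0 v x‖ₑ ^ 2 < ⊤) → (∫⁻ x, ‖iteratedFDeriv ℝ 1 v x‖ₑ ^ 2 < ⊤) → (∫⁻ x, ‖iteratedFDeriv ℝ 2 v x‖ₑ ^ 2 < ⊤) → |∫ x, ⟪Literature.Analysis.FluidPDE.curl v x, fderiv ℝ v x (Literature.Analysis.FluidPDE.curl v x)⟫_ℝ| ≤ κ * M * Real.sqrt (∫ x, ‖Literature.Analysis.FluidPDE.curl v x‖ ^ 2) * Real.sqrt (∫ x, Literature.Analysis.FluidPDE.frobeniusNormSq (fderiv ℝ (Literature.Analysis.FluidPDE.curl v) x)))}) * M * Real.sqrt (∫ x, ‖Literature.Analysis.FluidPDE.curl (W t) x‖ ^ 2) * Real.sqrt (∫ x,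 Literature.Analysis.FluidPDE.frobeniusNormSq (fderiv ℝ (Literature.Analysis.FluidPDE.curl (W t)) x)) ≤ |∫ x, ⟪Literature.Analysis.FluidPDE.curl (W t) x, fderiv ℝ (W t) x (Literature.Analysis.FluidPDE.curl (W t) x)⟫_ℝ|) := by
    by_contra hno
    have hsub : Set.Ioo a b ⊆ {t : ℝ | ¬ (t ∈ Set.Ioo a b → (ContDiff ℝ (⊤ : ℕ∞) (W t) ∧ Literature.Analysis.FluidPDE.VectorCalculus.IsDivFree (W t) ∧ (∃ B : ℝ, ∀ x, ‖fderiv ℝ (W t) x‖ ≤ B) ∧ (∫⁻ x, ‖iteratedFDeriv ℝ 1 (W t) x‖ₑ ^ 2 < ⊤) ∧ (∫⁻ x, ‖iteratedFDeriv ℝ 2 (W t) x‖ₑ ^ 2 < ⊤) ∧ ∃ M : ℝ, (∀ x, ‖(W t) x‖ ≤ M) ∧ 0 < M * Real.sqrt (∫ x, ‖Literature.Analysis.FluidPDE.curl (W t) x‖ ^ 2) * Real.sqrt (∫ x, Literature.Analysis.FluidPDE.frobeniusNormSq (fderiv ℝ (Literature.Analysis.FluidPDE.curl (W t)) x)) ∧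 (sInf {κ : ℝ | (∀ (v : EuclideanSpace ℝ (Fin 3) → EuclideanSpace ℝ (Fin 3)) (M B : ℝ), ContDiff ℝ (⊤ : ℕ∞) v → Literature.Analysis.FluidPDE.VectorCalculus.IsDivFree v → (∀ x, ‖v x‖ ≤ M) → (∀ x, ‖fderiv ℝ v x‖ ≤ B) → (∫⁻ x, ‖iteratedFDeriv ℝ 0 v x‖ₑ ^ 2 < ⊤) → (∫⁻ x, ‖iteratedFDeriv ℝ 1 v x‖ₑ ^ 2 < ⊤) → (∫⁻ x, ‖iteratedFDeriv ℝ 2 v x‖ₑ ^ 2 < ⊤) → |∫ x, ⟪Literature.Analysis.FluidPDE.curl v x, fderiv ℝ v x (Literature.Analysis.FluidPDE.curl v x)⟫_ℝ| ≤ κ * M * Real.sqrt (∫ x, ‖Literature.Analysis.FluidPDE.curl v x‖ ^ 2) * Real.sqrt (∫ x, Literature.Analysis.FluidPDE.frobeniusNormSq (fderiv ℝ (Literature.Analysis.FluidPDE.curl v) x)))}) * M * Real.sqrt (∫ x, ‖Literature.Analysis.FluidPDE.curl (W t) x‖ ^ 2) * Real.sqrt (∫ x, Literature.Analysis.FluidPDE.frobeniusNormSq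 (fderiv ℝ (Literature.Analysis.FluidPDE.curl (W t)) x)) ≤ |∫ x, ⟪Literature.Analysis.FluidPDE.curl (W t) x, fderiv ℝ (W t) x (Literature.Analysis.FluidPDE.curl (W t) x)⟫_ℝ|))} :=
      fun t ht himp => hno ⟨t, ht, himp ht⟩
    have h0 : volume (Set.Ioo a b) = 0 := measure_mono_null hsub (ae_iff.mp hae)
    rw [Real.volume_Ioo, ENNReal.ofReal_eq_zero] at h0
    linarith
  obtain ⟨t, ht, hcd, hdiv, hB, h1, h2, M, hM, hpos, hext⟩ := hex
  exact h1b ⟨W t, h1a W hW t (lt_of_lt_of_le ht.2 hb0), hcd, hdiv, hB, h1, h2, M, hM, hpos, hext⟩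

/-- **Composition (kernel-checked).**  K2 and K1 give ¬P; the rest is the block-to-log bookkeeping described in the module
docstring (`blocksToLog_general`, `intervalIntegrable_coeff_sq_div`, `sharpDepletion_gt`, `sharpDepletion_le`), with
θ := √(max β 0)/κ⋆ and B := max β 0 · L. -/
theorem NearExtremalTransience_of :
    Summit.NavierStokesRegularity.NavierStokesRegularity.Theses.ExtremiserTransience.NearExtremalTransience := by
  -- COMPACTNESS (stub K2) and RIGIDITY (proved above from the stubs K1a, K1b): the registered stubs enter BY NAME.
  have hK2 : (∀ β : ℝ, β < (sInf {κ : ℝ | (∀ (v : EuclideanSpace ℝ (Fin 3) → EuclideanSpace ℝ (Fin 3)) (M B : ℝ), ContDiff ℝ (⊤ : ℕ∞) v → Literature.Analysis.FluidPDE.VectorCalculus.IsDivFree v → (∀ x, ‖v x‖ ≤ M) → (∀ x, ‖fderiv ℝ v x‖ ≤ B) → (∫⁻ x, ‖iteratedFDeriv ℝ 0 v x‖ₑ ^ 2 < ⊤) → (∫⁻ x, ‖iteratedFDeriv ℝ 1 v x‖ₑ ^ 2 < ⊤) → (∫⁻ x, ‖iteratedFDeriv ℝ 2 v x‖ₑ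 ^ 2 < ⊤) → |∫ x, ⟪Literature.Analysis.FluidPDE.curl v x, fderiv ℝ v x (Literature.Analysis.FluidPDE.curl v x)⟫_ℝ| ≤ κ * M * Real.sqrt (∫ x, ‖Literature.Analysis.FluidPDE.curl v x‖ ^ 2) * Real.sqrt (∫ x, Literature.Analysis.FluidPDE.frobeniusNormSq (fderiv ℝ (Literature.Analysis.FluidPDE.curl v) x)))}) ^ 2 → ∀ L : ℝ, 0 < L → ∃ (C ν T : ℝ) (u : ℝ → EuclideanSpace ℝ (Fin 3) → EuclideanSpace ℝ (Fin 3)) (p : ℝ → EuclideanSpace ℝ (Fin 3) → ℝ), 0 < C ∧ 0 < ν ∧ 0 < T ∧ Literature.Analysis.FluidPDE.IsClassicalNSSolutionOn (Set.Ico 0 T) ν 0 u p ∧ Literature.Analysis.FluidPDE.IsLerayHopfOn T ν 0 (u 0) u ∧ Literature.Analysis.FluidPDE.HasRapidSpatialDecay (u 0) ∧ (∀ᶠ t in 𝓝[<] T, ∀ x, Real.sqrt (T - t) * ‖u t x‖ ≤ C * Real.sqrt ν) ∧ ¬ Literature.Analysis.FluidPDE.HasSmoothExtensionPast ν 0 u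 T ∧ ∀ (k : ℝ → ℝ), Measurable k → (∀ τ, 0 ≤ k τ ∧ k τ ≤ 1) → (∀ t ∈ Set.Ico 0 T, ∀ M : ℝ, (∀ x, ‖u t x‖ ≤ M) → |∫ x, ⟪Literature.Analysis.FluidPDE.curl (u t) x, fderiv ℝ (u t) x (Literature.Analysis.FluidPDE.curl (u t) x)⟫_ℝ| ≤ k t * M * Real.sqrt (∫ x, ‖Literature.Analysis.FluidPDE.curl (u t) x‖ ^ 2) * Real.sqrt (∫ x, Literature.Analysis.FluidPDE.frobeniusNormSq (fderiv ℝ (Literature.Analysis.FluidPDE.curl (u t)) x))) → ∀ t₁ ∈ Set.Ico 0 T, ∃ s₁ s₂ : ℝ, t₁ ≤ s₁ ∧ s₁ < s₂ ∧ s₂ < T ∧ L ≤ Real.log ((T - s₁) / (T - s₂)) ∧ β * Real.log ((T - s₁) / (T - s₂)) < ∫ τ in s₁..s₂, k τ ^ 2 / (T - τ)) → ∃ (W : ℝ → EuclideanSpace ℝ (Fin 3) → EuclideanSpace ℝ (Fin 3)) (a b : ℝ), (Literature.Analysis.FluidPDE.IsKNSSBlowupLimit W ∧ (∀ s t : ℝ,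 s < t → t < 0 → ∀ x, W t x = Literature.Analysis.FluidPDE.heatFlow (W s) (t - s) x - Literature.Analysis.FluidPDE.oseenDuhamel 1 s W W t x)) ∧ a < b ∧ b ≤ 0 ∧ ∀ᵐ t : ℝ, t ∈ Set.Ioo a b → (ContDiff ℝ (⊤ : ℕ∞) (W t) ∧ Literature.Analysis.FluidPDE.VectorCalculus.IsDivFree (W t) ∧ (∃ B : ℝ, ∀ x, ‖fderiv ℝ (W t) x‖ ≤ B) ∧ (∫⁻ x, ‖iteratedFDeriv ℝ 1 (W t) x‖ₑ ^ 2 < ⊤) ∧ (∫⁻ x, ‖iteratedFDeriv ℝ 2 (W t) x‖ₑ ^ 2 < ⊤) ∧ ∃ M : ℝ, (∀ x, ‖(W t) x‖ ≤ M) ∧ 0 < M * Real.sqrt (∫ x, ‖Literature.Analysis.FluidPDE.curl (W t) x‖ ^ 2) * Real.sqrt (∫ x, Literature.Analysis.FluidPDE.frobeniusNormSq (fderiv ℝ (Literature.Analysis.FluidPDE.curl (W t)) x)) ∧ (sInf {κ : ℝ | (∀ (v : EuclideanSpace ℝ (Fin 3) → EuclideanSpace ℝ (Fin 3)) (M B :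 ℝ), ContDiff ℝ (⊤ : ℕ∞) v → Literature.Analysis.FluidPDE.VectorCalculus.IsDivFree v → (∀ x, ‖v x‖ ≤ M) → (∀ x, ‖fderiv ℝ v x‖ ≤ B) → (∫⁻ x, ‖iteratedFDeriv ℝ 0 v x‖ₑ ^ 2 < ⊤) → (∫⁻ x, ‖iteratedFDeriv ℝ 1 v x‖ₑ ^ 2 < ⊤) → (∫⁻ x, ‖iteratedFDeriv ℝ 2 v x‖ₑ ^ 2 < ⊤) → |∫ x, ⟪Literature.Analysis.FluidPDE.curl v x, fderiv ℝ v x (Literature.Analysis.FluidPDE.curl v x)⟫_ℝ| ≤ κ * M * Real.sqrt (∫ x, ‖Literature.Analysis.FluidPDE.curl v x‖ ^ 2) * Real.sqrt (∫ x, Literature.Analysis.FluidPDE.frobeniusNormSq (fderiv ℝ (Literature.Analysis.FluidPDE.curl v) x)))}) * M * Real.sqrt (∫ x, ‖Literature.Analysis.FluidPDE.curl (W t) x‖ ^ 2) * Real.sqrt (∫ x, Literature.Analysis.FluidPDE.frobeniusNormSq (fderiv ℝ (Literature.Analysis.FluidPDE.curl (W t)) x)) ≤ |∫ x, ⟪Literature.Analysis.FluidPDE.curl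 (W t) x, fderiv ℝ (W t) x (Literature.Analysis.FluidPDE.curl (W t) x)⟫_ℝ|) := stub_extremalPersistenceCompactness
  have hK1 : ¬ (∃ (W : ℝ → EuclideanSpace ℝ (Fin 3) → EuclideanSpace ℝ (Fin 3)) (a b : ℝ), (Literature.Analysis.FluidPDE.IsKNSSBlowupLimit W ∧ (∀ s t : ℝ, s < t → t < 0 → ∀ x, W t x = Literature.Analysis.FluidPDE.heatFlow (W s) (t - s) x - Literature.Analysis.FluidPDE.oseenDuhamel 1 s W W t x)) ∧ a < b ∧ b ≤ 0 ∧ ∀ᵐ t : ℝ, t ∈ Set.Ioo a b → (ContDiff ℝ (⊤ : ℕ∞) (W t) ∧ Literature.Analysis.FluidPDE.VectorCalculus.IsDivFree (W t) ∧ (∃ B : ℝ, ∀ x, ‖fderiv ℝ (W t) x‖ ≤ B) ∧ (∫⁻ x, ‖iteratedFDeriv ℝ 1 (W t) x‖ₑ ^ 2 < ⊤) ∧ (∫⁻ x, ‖iteratedFDeriv ℝ 2 (W t) x‖ₑ ^ 2 < ⊤) ∧ ∃ M : ℝ, (∀ x, ‖(W t) x‖ ≤ M) ∧ 0 < M * Real.sqrt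 (∫ x, ‖Literature.Analysis.FluidPDE.curl (W t) x‖ ^ 2) * Real.sqrt (∫ x, Literature.Analysis.FluidPDE.frobeniusNormSq (fderiv ℝ (Literature.Analysis.FluidPDE.curl (W t)) x)) ∧ (sInf {κ : ℝ | (∀ (v : EuclideanSpace ℝ (Fin 3) → EuclideanSpace ℝ (Fin 3)) (M B : ℝ), ContDiff ℝ (⊤ : ℕ∞) v → Literature.Analysis.FluidPDE.VectorCalculus.IsDivFree v → (∀ x, ‖v x‖ ≤ M) → (∀ x, ‖fderiv ℝ v x‖ ≤ B) → (∫⁻ x, ‖iteratedFDeriv ℝ 0 v x‖ₑ ^ 2 < ⊤) → (∫⁻ x, ‖iteratedFDeriv ℝ 1 v x‖ₑ ^ 2 < ⊤) → (∫⁻ x, ‖iteratedFDeriv ℝ 2 v x‖ₑ ^ 2 < ⊤) → |∫ x, ⟪Literature.Analysis.FluidPDE.curl v x, fderiv ℝ v x (Literature.Analysis.FluidPDE.curl v x)⟫_ℝ| ≤ κ * M * Real.sqrt (∫ x, ‖Literature.Analysis.FluidPDE.curl v x‖ ^ 2) * Real.sqrt (∫ x, Literature.Analysis.FluidPDE.frobeniusNormSq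 (fderiv ℝ (Literature.Analysis.FluidPDE.curl v) x)))}) * M * Real.sqrt (∫ x, ‖Literature.Analysis.FluidPDE.curl (W t) x‖ ^ 2) * Real.sqrt (∫ x, Literature.Analysis.FluidPDE.frobeniusNormSq (fderiv ℝ (Literature.Analysis.FluidPDE.curl (W t)) x)) ≤ |∫ x, ⟪Literature.Analysis.FluidPDE.curl (W t) x, fderiv ℝ (W t) x (Literature.Analysis.FluidPDE.curl (W t) x)⟫_ℝ|)) := extremalAncient_false_of stub_analyticSlices noAnalyticExtremal
  have hnotP : ¬ (∀ β : ℝ, β < (sInf {κ : ℝ | (∀ (v : EuclideanSpace ℝ (Fin 3) → EuclideanSpace ℝ (Fin 3)) (M B : ℝ), ContDiff ℝ (⊤ : ℕ∞) v → Literature.Analysis.FluidPDE.VectorCalculus.IsDivFree v → (∀ x, ‖v x‖ ≤ M) → (∀ x, ‖fderiv ℝ v x‖ ≤ B) → (∫⁻ x, ‖iteratedFDeriv ℝ 0 v x‖ₑ ^ 2 < ⊤) → (∫⁻ x, ‖iteratedFDeriv ℝ 1 v x‖ₑ ^ 2 < ⊤) → (∫⁻ x, ‖iteratedFDeriv ℝ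 2 v x‖ₑ ^ 2 < ⊤) → |∫ x, ⟪Literature.Analysis.FluidPDE.curl v x, fderiv ℝ v x (Literature.Analysis.FluidPDE.curl v x)⟫_ℝ| ≤ κ * M * Real.sqrt (∫ x, ‖Literature.Analysis.FluidPDE.curl v x‖ ^ 2) * Real.sqrt (∫ x, Literature.Analysis.FluidPDE.frobeniusNormSq (fderiv ℝ (Literature.Analysis.FluidPDE.curl v) x)))}) ^ 2 → ∀ L : ℝ, 0 < L → ∃ (C ν T : ℝ) (u : ℝ → EuclideanSpace ℝ (Fin 3) → EuclideanSpace ℝ (Fin 3)) (p : ℝ → EuclideanSpace ℝ (Fin 3) → ℝ), 0 < C ∧ 0 < ν ∧ 0 < T ∧ Literature.Analysis.FluidPDE.IsClassicalNSSolutionOn (Set.Ico 0 T) ν 0 u p ∧ Literature.Analysis.FluidPDE.IsLerayHopfOn T ν 0 (u 0) u ∧ Literature.Analysis.FluidPDE.HasRapidSpatialDecay (u 0) ∧ (∀ᶠ t in 𝓝[<] T, ∀ x, Real.sqrt (T - t) * ‖u t x‖ ≤ C * Real.sqrt ν) ∧ ¬ Literature.Analysis.FluidPDE.HasSmoothExtensionPast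 ν 0 u T ∧ ∀ (k : ℝ → ℝ), Measurable k → (∀ τ, 0 ≤ k τ ∧ k τ ≤ 1) → (∀ t ∈ Set.Ico 0 T, ∀ M : ℝ, (∀ x, ‖u t x‖ ≤ M) → |∫ x, ⟪Literature.Analysis.FluidPDE.curl (u t) x, fderiv ℝ (u t) x (Literature.Analysis.FluidPDE.curl (u t) x)⟫_ℝ| ≤ k t * M * Real.sqrt (∫ x, ‖Literature.Analysis.FluidPDE.curl (u t) x‖ ^ 2) * Real.sqrt (∫ x, Literature.Analysis.FluidPDE.frobeniusNormSq (fderiv ℝ (Literature.Analysis.FluidPDE.curl (u t)) x))) → ∀ t₁ ∈ Set.Ico 0 T, ∃ s₁ s₂ : ℝ, t₁ ≤ s₁ ∧ s₁ < s₂ ∧ s₂ < T ∧ L ≤ Real.log ((T - s₁) / (T - s₂)) ∧ β * Real.log ((T - s₁) / (T - s₂)) < ∫ τ in s₁..s₂, k τ ^ 2 / (T - τ)) := fun hP => hK1 (hK2 hP)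
  -- Step 1: the uniform level β < κ⋆² and log-length L > 0.
  obtain ⟨β, hβ⟩ := not_forall.mp hnotP
  obtain ⟨hβlt, hβ2⟩ := Classical.not_imp.mp hβ
  obtain ⟨L, hL⟩ := not_forall.mp hβ2
  obtain ⟨hLpos, hrest⟩ := Classical.not_imp.mp hL
  -- constants of the sharp-constant API
  have hκgt : (13 : ℝ) / 200 < sInf {κ : ℝ | (∀ (v : EuclideanSpace ℝ (Fin 3) → EuclideanSpace ℝ (Fin 3)) (M B : ℝ), ContDiff ℝ (⊤ : ℕ∞) v → Literature.Analysis.FluidPDE.VectorCalculus.IsDivFree v → (∀ x, ‖v x‖ ≤ M) → (∀ x, ‖fderiv ℝ v x‖ ≤ B) → (∫⁻ x, ‖iteratedFDeriv ℝ 0 v x‖ₑ ^ 2 < ⊤) → (∫⁻ x, ‖iteratedFDeriv ℝ 1 v x‖ₑ ^ 2 < ⊤) → (∫⁻ x, ‖iteratedFDeriv ℝ 2 v x‖ₑ ^ 2 < ⊤) → |∫ x, ⟪Literature.Analysis.FluidPDE.curl v x, fderiv ℝ v x (Literature.Analysis.FluidPDE.curl v x)⟫_ℝ| ≤ κ * M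 * Real.sqrt (∫ x, ‖Literature.Analysis.FluidPDE.curl v x‖ ^ 2) * Real.sqrt (∫ x, Literature.Analysis.FluidPDE.frobeniusNormSq (fderiv ℝ (Literature.Analysis.FluidPDE.curl v) x)))} := sharpDepletion_gt
  have hκpos : (0 : ℝ) < sInf {κ : ℝ | (∀ (v : EuclideanSpace ℝ (Fin 3) → EuclideanSpace ℝ (Fin 3)) (M B : ℝ), ContDiff ℝ (⊤ : ℕ∞) v → Literature.Analysis.FluidPDE.VectorCalculus.IsDivFree v → (∀ x, ‖v x‖ ≤ M) → (∀ x, ‖fderiv ℝ v x‖ ≤ B) → (∫⁻ x, ‖iteratedFDeriv ℝ 0 v x‖ₑ ^ 2 < ⊤) → (∫⁻ x, ‖iteratedFDeriv ℝ 1 v x‖ₑ ^ 2 < ⊤) → (∫⁻ x, ‖iteratedFDeriv ℝ 2 v x‖ₑ ^ 2 < ⊤) → |∫ x, ⟪Literature.Analysis.FluidPDE.curl v x, fderiv ℝ v x (Literature.Analysis.FluidPDE.curl v x)⟫_ℝ| ≤ κ * M * Real.sqrt (∫ x, ‖Literature.Analysis.FluidPDE.curl v x‖ ^ 2) * Real.sqrt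 (∫ x, Literature.Analysis.FluidPDE.frobeniusNormSq (fderiv ℝ (Literature.Analysis.FluidPDE.curl v) x)))} := lt_trans (by norm_num) hκgt
  have hm0 : (0 : ℝ) ≤ max β 0 := le_max_right _ _
  have hA0 : (0 : ℝ) ≤ max β 0 * L := mul_nonneg hm0 hLpos.le
  refine ⟨Real.sqrt (max β 0) / sInf {κ : ℝ | (∀ (v : EuclideanSpace ℝ (Fin 3) → EuclideanSpace ℝ (Fin 3)) (M B : ℝ), ContDiff ℝ (⊤ : ℕ∞) v → Literature.Analysis.FluidPDE.VectorCalculus.IsDivFree v → (∀ x, ‖v x‖ ≤ M) → (∀ x, ‖fderiv ℝ v x‖ ≤ B) → (∫⁻ x, ‖iteratedFDeriv ℝ 0 v x‖ₑ ^ 2 < ⊤) → (∫⁻ x, ‖iteratedFDeriv ℝ 1 v x‖ₑ ^ 2 < ⊤) → (∫⁻ x, ‖iteratedFDeriv ℝ 2 v x‖ₑ ^ 2 < ⊤) → |∫ x, ⟪Literature.Analysis.FluidPDE.curl v x, fderiv ℝ v x (Literature.Analysis.FluidPDE.curl v x)⟫_ℝ| ≤ κ * M * Real.sqrt (∫ x,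 ‖Literature.Analysis.FluidPDE.curl v x‖ ^ 2) * Real.sqrt (∫ x, Literature.Analysis.FluidPDE.frobeniusNormSq (fderiv ℝ (Literature.Analysis.FluidPDE.curl v) x)))}, div_nonneg (Real.sqrt_nonneg _) hκpos.le, ?_, ?_⟩
  · rw [div_lt_one hκpos, Real.sqrt_lt' hκpos]
    exact max_lt hβlt (by positivity)
  intro κ hκ C ν T hC hν hT u p hcl hLH hdec hrate hsing
  have hκle : sInf {κ : ℝ | (∀ (v : EuclideanSpace ℝ (Fin 3) → EuclideanSpace ℝ (Fin 3)) (M B : ℝ), ContDiff ℝ (⊤ : ℕ∞) v → Literature.Analysis.FluidPDE.VectorCalculus.IsDivFree v → (∀ x, ‖v x‖ ≤ M) → (∀ x, ‖fderiv ℝ v x‖ ≤ B) → (∫⁻ x, ‖iteratedFDeriv ℝ 0 v x‖ₑ ^ 2 < ⊤) → (∫⁻ x, ‖iteratedFDeriv ℝ 1 v x‖ₑ ^ 2 < ⊤) → (∫⁻ x, ‖iteratedFDeriv ℝ 2 v x‖ₑ ^ 2 < ⊤) → |∫ x, ⟪Literature.Analysis.FluidPDE.curl v x, fderiv ℝ v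 x (Literature.Analysis.FluidPDE.curl v x)⟫_ℝ| ≤ κ * M * Real.sqrt (∫ x, ‖Literature.Analysis.FluidPDE.curl v x‖ ^ 2) * Real.sqrt (∫ x, Literature.Analysis.FluidPDE.frobeniusNormSq (fderiv ℝ (Literature.Analysis.FluidPDE.curl v) x)))} ≤ κ := sharpDepletion_le hκ
  -- Step 2: along this flow, some admissible coefficient k and onset t₁ have only subextremal long windows.
  have hk : ¬ (∀ (k : ℝ → ℝ), Measurable k → (∀ τ, 0 ≤ k τ ∧ k τ ≤ 1) → (∀ t ∈ Set.Ico 0 T, ∀ M : ℝ, (∀ x, ‖u t x‖ ≤ M) → |∫ x, ⟪Literature.Analysis.FluidPDE.curl (u t) x, fderiv ℝ (u t) x (Literature.Analysis.FluidPDE.curl (u t) x)⟫_ℝ| ≤ k t * M * Real.sqrt (∫ x, ‖Literature.Analysis.FluidPDE.curl (u t) x‖ ^ 2) * Real.sqrt (∫ x, Literature.Analysis.FluidPDE.frobeniusNormSq (fderiv ℝ (Literature.Analysis.FluidPDE.curl (u t)) x))) → ∀ t₁ ∈ Set.Ico 0 T, ∃ s₁ s₂ : ℝ, t₁ ≤ s₁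 ∧ s₁ < s₂ ∧ s₂ < T ∧ L ≤ Real.log ((T - s₁) / (T - s₂)) ∧ β * Real.log ((T - s₁) / (T - s₂)) < ∫ τ in s₁..s₂, k τ ^ 2 / (T - τ)) := fun hall =>
    hrest ⟨C, ν, T, u, p, hC, hν, hT, hcl, hLH, hdec, hrate, hsing, hall⟩
  obtain ⟨k, hk1⟩ := not_forall.mp hk
  obtain ⟨hkm, hk2⟩ := Classical.not_imp.mp hk1
  obtain ⟨hk01, hk3⟩ := Classical.not_imp.mp hk2
  obtain ⟨hclause, hk4⟩ := Classical.not_imp.mp hk3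
  obtain ⟨t₁, ht₁'⟩ := not_forall.mp hk4
  obtain ⟨ht₁, hnowin⟩ := Classical.not_imp.mp ht₁'
  have hwin : ∀ s₁ s₂ : ℝ, t₁ ≤ s₁ → s₁ < s₂ → s₂ < T → L ≤ Real.log ((T - s₁) / (T - s₂)) →
      ∫ τ in s₁..s₂, k τ ^ 2 / (T - τ) ≤ β * Real.log ((T - s₁) / (T - s₂)) :=
    fun s₁ s₂ h1 h2 h3 h4 => not_lt.mp fun hlt => hnowin ⟨s₁, s₂, h1, h2, h3, h4, hlt⟩
  have hTt₁ : 0 < T - t₁ := sub_pos.mpr ht₁.2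
  -- Step 3: geometric blocks of log-length exactly L carry mass ≤ max β 0 · L.
  have hblock : ∀ n : ℕ, ∫ τ in (T - (T - t₁) * Real.exp (-(n * L)))..(T - (T - t₁) * Real.exp (-((n + 1) * L))), k τ ^ 2 / (T - τ) ≤ max β 0 * L := by
    intro n
    have hn : (0 : ℝ) ≤ n := n.cast_nonneg
    have he1 : Real.exp (-(n * L)) ≤ 1 := by
      rw [Real.exp_le_one_iff]
      have := mul_nonneg hn hLpos.le
      linarith
    have he2 : Real.exp (-((n + 1) * L)) < Real.exp (-(n * L)) := by
      rw [Real.exp_lt_exp]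
      have : ((n : ℝ) + 1) * L = n * L + L := by ring
      rw [this]
      linarith
    have h1 : t₁ ≤ (T - (T - t₁) * Real.exp (-(n * L))) := by
      have := mul_le_mul_of_nonneg_left he1 hTt₁.le
      linarith
    have h2 : (T - (T - t₁) * Real.exp (-(n * L))) < (T - (T - t₁) * Real.exp (-((n + 1) * L))) := by
      have := mul_lt_mul_of_pos_left he2 hTt₁
      linarith
    have h3 : (T - (T - t₁) * Real.exp (-((n + 1) * L))) < T := by
      have := mul_pos hTt₁ (Real.exp_pos (-((n + 1) * L)))
      linarith
    have hratio : (T - (T - (T - t₁) * Real.exp (-(n * L)))) / (T - (T - (T - t₁) * Real.exp (-((n + 1) * L)))) = Real.exp L := by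
      rw [show T - (T - (T - t₁) * Real.exp (-(n * L))) = (T - t₁) * Real.exp (-(n * L)) by ring,
        show T - (T - (T - t₁) * Real.exp (-((n + 1) * L))) = (T - t₁) * Real.exp (-((n + 1) * L)) by ring,
        mul_div_mul_left _ _ hTt₁.ne', ← Real.exp_sub]
      congr 1
      ring
    have hlog : Real.log ((T - (T - (T - t₁) * Real.exp (-(n * L)))) / (T - (T - (T - t₁) * Real.exp (-((n + 1) * L))))) = L := by
      rw [hratio, Real.log_exp]
    have hw := hwin (T - (T - t₁) * Real.exp (-(n * L))) (T - (T - t₁) * Real.exp (-((n + 1) * L))) h1 h2 h3 (le_of_eq hlog.symm)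
    rw [hlog] at hw
    exact hw.trans (mul_le_mul_of_nonneg_right (le_max_left _ _) hLpos.le)
  -- Step 4: sum the blocks (tree lemma) and restrict the flow-wise clause to [t₁, T).
  have hmain := blocksToLog_general (g := fun τ => k τ ^ 2 / (T - τ)) (t₁ := t₁) (T := T) (A := max β 0 * L) (ℓ := L)
    ht₁.2 hA0 hLpos (fun τ hτ => div_nonneg (sq_nonneg _) (sub_nonneg.mpr (le_of_lt hτ.2)))
    (fun t ht => intervalIntegrable_coeff_sq_div hkm hk01 ht.1 ht.2) hblock
  refine ⟨t₁, ht₁, k, max β 0 * L, hkm, hk01, fun t ht M hM => hclause t ⟨ht₁.1.trans ht.1, ht.2⟩ M hM, fun t ht => ?_⟩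
  have h := hmain t ht
  have hlog0 : 0 ≤ Real.log ((T - t₁) / (T - t)) := by
    apply Real.log_nonneg
    rw [le_div_iff₀ (sub_pos.mpr ht.2)]
    linarith [ht.1]
  have hcoef : max β 0 * L / L ≤ (Real.sqrt (max β 0) / sInf {κ : ℝ | (∀ (v : EuclideanSpace ℝ (Fin 3) → EuclideanSpace ℝ (Fin 3)) (M B : ℝ), ContDiff ℝ (⊤ : ℕ∞) v → Literature.Analysis.FluidPDE.VectorCalculus.IsDivFree v → (∀ x, ‖v x‖ ≤ M) → (∀ x, ‖fderiv ℝ v x‖ ≤ B) → (∫⁻ x, ‖iteratedFDeriv ℝ 0 v x‖ₑ ^ 2 < ⊤) → (∫⁻ x, ‖iteratedFDeriv ℝ 1 v x‖ₑ ^ 2 < ⊤) → (∫⁻ x, ‖iteratedFDeriv ℝ 2 v x‖ₑ ^ 2 < ⊤) → |∫ x, ⟪Literature.Analysis.FluidPDE.curl v x, fderiv ℝ v x (Literature.Analysis.FluidPDE.curl v x)⟫_ℝ| ≤ κ * M * Real.sqrt (∫ x, ‖Literature.Analysis.FluidPDE.curl v x‖ ^ 2) * Real.sqrt (∫ x, Literature.Analysis.FluidPDE.frobeniusNormSq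 (fderiv ℝ (Literature.Analysis.FluidPDE.curl v) x)))} * κ) ^ 2 := by
    rw [mul_div_assoc, div_self hLpos.ne', mul_one, div_mul_eq_mul_div, div_pow, mul_pow, Real.sq_sqrt hm0,
      le_div_iff₀ (pow_pos hκpos 2)]
    exact mul_le_mul_of_nonneg_left (pow_le_pow_left₀ hκpos.le hκle 2) hm0
  exact h.trans (add_le_add (mul_le_mul_of_nonneg_right hcoef hlog0) le_rfl)

-- audit: the composition concludes the crux BY NAME; sorries only in the three stubs.
#print axioms NearExtremalTransience_of

#print axioms noAnalyticExtremal

end Summit.NavierStokesRegularity.NavierStokesRegularity.Cruxes.NearExtremalTransience.KernelBudget
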